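/-
Copyright (c) 2026. All rights reserved.
Released under Apache 2.0 license as described in the file LICENSE.
Authors: HodgeCM publication cell (pub-hodgecm), GR lane, seat GR-2 (`pub-hodgecm-own-hyp34`).
-/
import Literature.NumberTheory.Weil1964.ArchFollandTorusAdelic
import HarnessLib

/-!
# The scaled Folland frame of `W_∞ = ((F ⊗ ℝ)^ι)²` for an ARBITRARY number field `F` (real and complex places)

Topic `NumberTheory/Weil1964`; namespace `Literature.NumberTheory.Weil1964`.  KERNEL ONLY: definitions with bodies and
theorems; no `def … : Prop` record, no `axiom`, no proof hole.

`ArchFollandTorusAdelic.scaledFrame` (the real frame `e_D : (F ⊗ ℝ)^ι ≃L[ℝ] ℝ^{ι × places}` in which the tree reads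
the archimedean Weil representation through Folland's metaplectic group, `AdelicMetaplecticArchSection.archLift`) is
written for `F` TOTALLY REAL.  This file is its twin for a general number field `F`
(`F ⊗_ℚ ℝ = ℝ^{r₁} × ℂ^{r₂}` = Mathlib's `mixedSpace F`): the frame index is

  `FrameIdx F ι = (ι × {v real}) ⊕ ((ι ⊕ ι) × {v complex})`

(one real coordinate per real place, a real-part and an imaginary-part coordinate per complex place), and the frame
`scaledFrameGen F ι D hD C hC` scales the real coordinates by `D_{j,v} ∈ ℝˣ` and the complex ones by `C_{j,v} ∈ ℂˣ`
before taking `(re, im)`: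

* §1 `placeVecC v a = ((a_j)_v)_j ∈ ℂ^ι` (complex twin of `placeVec`), `reImVec z = (re z, im z) ∈ ℝ^{ι ⊕ ι}`;
* §2 `scaledFrameGen` and its slices: `realSlice v (e a) = D_{·,v} · a_v`, `cxSlice v (e a) = reImVec (C_{·,v} · a_v)`;
* §3 Folland's frequency vector in this frame (`follandFreq`, sign = Tate's `ψ_∞ = e^{-2πi Tr}`; the trace form of
  `F ⊗ ℝ` weighs a complex place by `2 re`, `mixedTrace`):
  `q_{(j,v)} = -(w_j)_v / D_{j,v}` (real `v`), `q_{(re j, v)} = -2 re((w_j)_v / C_{j,v})`,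
  `q_{(im j, v)} = 2 im((w_j)_v / C_{j,v})` (complex `v`);
* §4 for an `F`-rational Gram matrix `T = T₀ ⊗ 1` the Folland coordinates `Ξ_e(a, w) = (e a, follandFreq e (T_∞ w))`
  (`archFolland`) slice by slice: at a real place the adapted Folland scaling `follandScale` of `ArchFollandTorus`
  (`realSlice_archFolland`, for diagonal `T₀` literally `archFolland_scaledFrame`'s formula), at a complex place the
  map **`cxFollandScale C T_v (a, w) = (reImVec (C a), reImVec (-2 conj(T_v w / C)))`** (`cxSlice_archFolland`).

These are the bookkeeping identities behind the archimedean half of the Weil splitting of a unitary group over a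
general quadratic extension `E/F` ([GelbartRogawski1991] §3.1 Prop. 3.1.1: real places of `F` inert in `E` are read
through Folland's `U(p,q) ⊂ Sp_{2n}(ℝ)` as in the CM case; real places split in `E` and complex places through a
conjugate of the Siegel Levi, `ArchSplitPlaceLeviSection` / the sequel); no analysis here.

## References
* [Folland1989] G. B. Folland, *Harmonic Analysis in Phase Space*, Princeton UP (1989), §1.3 (1.25), Prop. (1.43),
  Ch. 4 §1 Prop. (4.6).
* [Weil1964] A. Weil, *Sur certains groupes d'opérateurs unitaires*, Acta Math. 111 (1964), Chap. III n° 37–38.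
* [GelbartRogawski1991] S. Gelbart, J. Rogawski, Invent. math. 105 (1991), §3.1 p. 454.
-/

set_option autoImplicit false

noncomputable section

open scoped Matrix Real Classical ComplexConjugate
open Complex NumberField NumberField.InfinitePlace NumberField.mixedEmbedding IsDedekindDomain
open Literature.NumberTheory.Automorphic
open Literature.RepresentationTheory.HeisenbergGroup Literature.Analysis.SegalBargmann

namespace Literature.NumberTheory.Weil1964

variable {F : Type} [Field F] [NumberField F] {ι : Type} [Fintype ι] [DecidableEq ι]

/-! ## §1 Complex-place coordinates and the `(re, im)` packing -/

section Coordinates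

variable (F ι) in
/-- The `v`-components of an archimedean vector at a COMPLEX place: `placeVecC v a = ((a j)_v)_j ∈ ℂ^ι`.
[cite: Folland1989, Ch. 4 §1 Prop. (4.6)] -/
def placeVecC (v : {v : InfinitePlace F // v.IsComplex}) (a : ι → mixedSpace F) : ι → ℂ := fun j => (a j).2 v

omit [NumberField F] [Fintype ι] [DecidableEq ι] in
/-- see `placeVecC`. [cite: Folland1989, Ch. 4 §1 Prop. (4.6)] -/
@[simp] theorem placeVecC_apply (v : {v : InfinitePlace F // v.IsComplex}) (a : ι → mixedSpace F) (j : ι) :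
    placeVecC F ι v a j = (a j).2 v := rfl

variable (ι) in
/-- `reImVec z = (re z, im z) ∈ ℝ^{ι ⊕ ι}`: the realification `ℂ^ι = ℝ^ι ⊕ i ℝ^ι` as a vector on `ι ⊕ ι`.
[cite: Folland1989, Ch. 4 §1 Prop. (4.6)] -/
def reImVec (z : ι → ℂ) : ι ⊕ ι → ℝ := Sum.elim (fun j => (z j).re) (fun j => (z j).im)

omit [Fintype ι] [DecidableEq ι] in
/-- `reImVec z (inl j) = re (z j)`. [cite: Folland1989, Ch. 4 §1 Prop. (4.6)] -/
@[simp] theorem reImVec_inl (z : ι → ℂ) (j : ι) : reImVec ι z (Sum.inl j) = (z j).re := rfl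

omit [Fintype ι] [DecidableEq ι] in
/-- `reImVec z (inr j) = im (z j)`. [cite: Folland1989, Ch. 4 §1 Prop. (4.6)] -/
@[simp] theorem reImVec_inr (z : ι → ℂ) (j : ι) : reImVec ι z (Sum.inr j) = (z j).im := rfl

variable (ι) in
/-- the inverse packing `ℝ^{ι ⊕ ι} → ℂ^ι`, `p ↦ (p (inl j) + i p (inr j))_j`. [cite: Folland1989, Ch. 4 §1 Prop. (4.6)] -/
def ofReImVec (p : ι ⊕ ι → ℝ) : ι → ℂ := fun j => ⟨p (Sum.inl j), p (Sum.inr j)⟩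

omit [Fintype ι] [DecidableEq ι] in
/-- `ofReImVec (reImVec z) = z`. [cite: Folland1989, Ch. 4 §1 Prop. (4.6)] -/
@[simp] theorem ofReImVec_reImVec (z : ι → ℂ) : ofReImVec ι (reImVec ι z) = z :=
  funext fun j => Complex.eta (z j)

omit [Fintype ι] [DecidableEq ι] in
/-- `reImVec (ofReImVec p) = p`. [cite: Folland1989, Ch. 4 §1 Prop. (4.6)] -/
@[simp] theorem reImVec_ofReImVec (p : ι ⊕ ι → ℝ) : reImVec ι (ofReImVec ι p) = p := by
  funext k
  rcases k with j | j <;> rfl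

omit [Fintype ι] [DecidableEq ι] in
/-- `reImVec` is injective. [cite: Folland1989, Ch. 4 §1 Prop. (4.6)] -/
theorem reImVec_injective : Function.Injective (reImVec ι) := fun z z' h => by
  rw [← ofReImVec_reImVec z, h, ofReImVec_reImVec]

omit [Fintype ι] [DecidableEq ι] in
/-- `reImVec` is additive. [cite: Folland1989, Ch. 4 §1 Prop. (4.6)] -/
theorem reImVec_add (z z' : ι → ℂ) : reImVec ι (z + z') = reImVec ι z + reImVec ι z' := by
  funext k
  rcases k with j | j <;> simp [reImVec]

omit [Fintype ι] [DecidableEq ι] in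
/-- `reImVec` commutes with real scalars. [cite: Folland1989, Ch. 4 §1 Prop. (4.6)] -/
theorem reImVec_smul (c : ℝ) (z : ι → ℂ) : reImVec ι (c • z) = c • reImVec ι z := by
  funext k
  rcases k with j | j <;> simp [reImVec]

end Coordinates

/-! ## §2 The frame index and the general scaled frame -/

section Frame

variable (F ι) in
/-- **the frame index of `(F ⊗ ℝ)^ι` as a real vector space**: one coordinate `(j, v)` per real place, two
coordinates `(inl j, v)` (real part), `(inr j, v)` (imaginary part) per complex place. [cite: Weil1964, Chap. III n° 37] -/
abbrev FrameIdx : Type :=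
  (ι × {v : InfinitePlace F // v.IsReal}) ⊕ ((ι ⊕ ι) × {v : InfinitePlace F // v.IsComplex})

variable (F ι) in
/-- **The scaled frame of `(F ⊗ ℝ)^ι` for a general number field**: `a ↦` (`(j,v) ↦ D_{j,v} (a_j)_v` at real `v`;
`(inl j, v) ↦ re(C_{j,v} (a_j)_v)`, `(inr j, v) ↦ im(C_{j,v} (a_j)_v)` at complex `v`), all `D_{j,v} ≠ 0`, `C_{j,v} ≠ 0`;
a continuous linear isomorphism `(F ⊗ ℝ)^ι ≃ ℝ^{FrameIdx}`. [cite: Folland1989, §1.3 (1.25)] -/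
def scaledFrameGen (D : ι × {v : InfinitePlace F // v.IsReal} → ℝ) (hD : ∀ k, D k ≠ 0)
    (C : ι × {v : InfinitePlace F // v.IsComplex} → ℂ) (hC : ∀ k, C k ≠ 0) :
    (ι → mixedSpace F) ≃L[ℝ] (FrameIdx F ι → ℝ) :=
  LinearEquiv.toContinuousLinearEquiv
    { toFun := fun a => Sum.elim (fun k => D k * (a k.1).1 k.2)
        (fun k => Sum.elim (fun j => (C (j, k.2) * (a j).2 k.2).re) (fun j => (C (j, k.2) * (a j).2 k.2).im) k.1)
      invFun := fun p j => (fun v => p (Sum.inl (j, v)) / D (j, v),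
        fun v => (C (j, v))⁻¹ * ⟨p (Sum.inr (Sum.inl j, v)), p (Sum.inr (Sum.inr j, v))⟩)
      map_add' := fun a b => by
        funext k
        rcases k with ⟨j, v⟩ | ⟨i | i, v⟩ <;>
          simp only [Sum.elim_inl, Sum.elim_inr, Pi.add_apply, Prod.fst_add, Prod.snd_add, mul_add, Complex.add_re,
            Complex.add_im]
      map_smul' := fun c a => by
        funext k
        rcases k with ⟨j, v⟩ | ⟨i | i, v⟩
        · simp only [Sum.elim_inl, Pi.smul_apply, Prod.smul_fst, smul_eq_mul, RingHom.id_apply]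
          ring
        · simp only [Sum.elim_inr, Sum.elim_inl, Pi.smul_apply, Prod.smul_snd, Complex.real_smul, RingHom.id_apply,
            smul_eq_mul, ← mul_assoc, mul_comm (C (i, v)) (c : ℂ)]
          rw [mul_assoc, Complex.re_ofReal_mul]
        · simp only [Sum.elim_inr, Pi.smul_apply, Prod.smul_snd, Complex.real_smul, RingHom.id_apply,
            smul_eq_mul, ← mul_assoc, mul_comm (C (i, v)) (c : ℂ)]
          rw [mul_assoc, Complex.im_ofReal_mul]
      left_inv := fun a => by
        funext j
        refine Prod.ext (funext fun v => ?_) (funext fun v => ?_)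
        · simp only [Sum.elim_inl, mul_div_cancel_left₀ _ (hD (j, v))]
        · simp only [Sum.elim_inr, Sum.elim_inl, Complex.eta, ← mul_assoc, inv_mul_cancel₀ (hC (j, v)), one_mul]
      right_inv := fun p => by
        funext k
        rcases k with ⟨j, v⟩ | ⟨i | i, v⟩
        · simp only [Sum.elim_inl, mul_div_cancel₀ _ (hD (j, v))]
        · simp only [Sum.elim_inr, Sum.elim_inl, ← mul_assoc, mul_inv_cancel₀ (hC (i, v)), one_mul]
        · simp only [Sum.elim_inr, ← mul_assoc, mul_inv_cancel₀ (hC (i, v)), one_mul] }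

variable {D : ι × {v : InfinitePlace F // v.IsReal} → ℝ} {hD : ∀ k, D k ≠ 0}
  {C : ι × {v : InfinitePlace F // v.IsComplex} → ℂ} {hC : ∀ k, C k ≠ 0}

omit [DecidableEq ι] in
/-- the real coordinate `(j, v)`: `D_{j,v} (a_j)_v`. [cite: Folland1989, §1.3 (1.25)] -/
@[simp] theorem scaledFrameGen_apply_inl (a : ι → mixedSpace F) (k : ι × {v : InfinitePlace F // v.IsReal}) :
    scaledFrameGen F ι D hD C hC a (Sum.inl k) = D k * (a k.1).1 k.2 := rfl

omit [DecidableEq ι] in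
/-- the coordinate `(inl j, v)`, `v` complex: `re(C_{j,v} (a_j)_v)`. [cite: Folland1989, §1.3 (1.25)] -/
@[simp] theorem scaledFrameGen_apply_inr_inl (a : ι → mixedSpace F) (j : ι) (v : {v : InfinitePlace F // v.IsComplex}) :
    scaledFrameGen F ι D hD C hC a (Sum.inr (Sum.inl j, v)) = (C (j, v) * (a j).2 v).re := rfl

omit [DecidableEq ι] in
/-- the coordinate `(inr j, v)`, `v` complex: `im(C_{j,v} (a_j)_v)`. [cite: Folland1989, §1.3 (1.25)] -/
@[simp] theorem scaledFrameGen_apply_inr_inr (a : ι → mixedSpace F) (j : ι) (v : {v : InfinitePlace F // v.IsComplex}) :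
    scaledFrameGen F ι D hD C hC a (Sum.inr (Sum.inr j, v)) = (C (j, v) * (a j).2 v).im := rfl

omit [DecidableEq ι] in
/-- the inverse frame, real places: `((e⁻¹ p)_j)_v = p (j, v) / D_{j,v}`. [cite: Folland1989, §1.3 (1.25)] -/
theorem scaledFrameGen_symm_apply_fst (p : FrameIdx F ι → ℝ) (j : ι) (v : {v : InfinitePlace F // v.IsReal}) :
    ((scaledFrameGen F ι D hD C hC).symm p j).1 v = p (Sum.inl (j, v)) / D (j, v) := rfl

omit [DecidableEq ι] in
/-- the inverse frame, complex places: `((e⁻¹ p)_j)_v = C_{j,v}⁻¹ (p (inl j, v) + i p (inr j, v))`. [cite: Folland1989, §1.3 (1.25)] -/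
theorem scaledFrameGen_symm_apply_snd (p : FrameIdx F ι → ℝ) (j : ι) (v : {v : InfinitePlace F // v.IsComplex}) :
    ((scaledFrameGen F ι D hD C hC).symm p j).2 v =
      (C (j, v))⁻¹ * ⟨p (Sum.inr (Sum.inl j, v)), p (Sum.inr (Sum.inr j, v))⟩ := rfl

variable (ι) in
/-- the real slice at a real place: `realSlice v p = (p (j, v))_j`. [cite: Weil1964, Chap. III n° 37] -/
def realSlice (v : {v : InfinitePlace F // v.IsReal}) (p : FrameIdx F ι → ℝ) : ι → ℝ := fun j => p (Sum.inl (j, v))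

variable (ι) in
/-- the slice at a complex place: `cxSlice v p = (p (i, v))_{i ∈ ι ⊕ ι}`. [cite: Weil1964, Chap. III n° 37] -/
def cxSlice (v : {v : InfinitePlace F // v.IsComplex}) (p : FrameIdx F ι → ℝ) : ι ⊕ ι → ℝ := fun i => p (Sum.inr (i, v))

omit [NumberField F] [Fintype ι] [DecidableEq ι] in
/-- see `realSlice`. [cite: Weil1964, Chap. III n° 37] -/
@[simp] theorem realSlice_apply (v : {v : InfinitePlace F // v.IsReal}) (p : FrameIdx F ι → ℝ) (j : ι) :
    realSlice ι v p j = p (Sum.inl (j, v)) := rfl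

omit [NumberField F] [Fintype ι] [DecidableEq ι] in
/-- see `cxSlice`. [cite: Weil1964, Chap. III n° 37] -/
@[simp] theorem cxSlice_apply (v : {v : InfinitePlace F // v.IsComplex}) (p : FrameIdx F ι → ℝ) (i : ι ⊕ ι) :
    cxSlice ι v p i = p (Sum.inr (i, v)) := rfl

omit [NumberField F] [Fintype ι] [DecidableEq ι] in
/-- a vector of `ℝ^{FrameIdx}` is determined by its slices. [cite: Weil1964, Chap. III n° 37] -/
theorem eq_of_slices_eq {p q : FrameIdx F ι → ℝ} (hr : ∀ v, realSlice ι v p = realSlice ι v q)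
    (hc : ∀ v, cxSlice ι v p = cxSlice ι v q) : p = q := by
  funext k
  rcases k with ⟨j, v⟩ | ⟨i, v⟩
  · exact congrFun (hr v) j
  · exact congrFun (hc v) i

omit [DecidableEq ι] in
/-- **the real slice of the frame**: `realSlice v (e a) = (D_{j,v} (a_j)_v)_j`. [cite: Folland1989, §1.3 (1.25)] -/
theorem realSlice_scaledFrameGen (v : {v : InfinitePlace F // v.IsReal}) (a : ι → mixedSpace F) :
    realSlice ι v (scaledFrameGen F ι D hD C hC a) = fun j => D (j, v) * placeVec F ι v a j := rfl

omit [DecidableEq ι] in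
/-- **the complex slice of the frame**: `cxSlice v (e a) = reImVec (C_{·,v} · a_v)`. [cite: Folland1989, §1.3 (1.25)] -/
theorem cxSlice_scaledFrameGen (v : {v : InfinitePlace F // v.IsComplex}) (a : ι → mixedSpace F) :
    cxSlice ι v (scaledFrameGen F ι D hD C hC a) = reImVec ι fun j => C (j, v) * placeVecC F ι v a j := by
  funext i
  rcases i with j | j <;> rfl

end Frame

/-! ## §3 Folland's frequency vector in the general frame -/

section Freq

variable {D : ι × {v : InfinitePlace F // v.IsReal} → ℝ} {hD : ∀ k, D k ≠ 0}
  {C : ι × {v : InfinitePlace F // v.IsComplex} → ℂ} {hC : ∀ k, C k ≠ 0}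

/-- **`follandFreq` at a real coordinate**: `q_{(j,v)} = -(w_j)_v / D_{j,v}`. [cite: Folland1989, §1.3 (1.25)] -/
theorem follandFreq_scaledFrameGen_inl (w : ι → mixedSpace F) (j : ι) (v : {v : InfinitePlace F // v.IsReal}) :
    follandFreq F ι (scaledFrameGen F ι D hD C hC) w (Sum.inl (j, v)) = -((w j).1 v) / D (j, v) := by
  rw [follandFreq, piTracePairing_apply, neg_div, neg_inj]
  simp only [mixedTrace_apply, Prod.fst_mul, Prod.snd_mul, Pi.mul_apply, scaledFrameGen_symm_apply_fst,
    scaledFrameGen_symm_apply_snd, Pi.single_apply, Sum.inl.injEq, Prod.mk.injEq, reduceCtorEq, if_false]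
  have h0 : (⟨0, 0⟩ : ℂ) = 0 := rfl
  simp only [h0, mul_zero, zero_mul, Complex.zero_re, Finset.sum_const_zero, add_zero]
  rw [Finset.sum_eq_single_of_mem j (Finset.mem_univ _) (fun x _ hx => Finset.sum_eq_zero fun y _ => by
      rw [if_neg (fun h => hx h.1), zero_div, zero_mul]),
    Finset.sum_eq_single_of_mem v (Finset.mem_univ _) (fun y _ hy => by
      rw [if_neg (fun h => hy h.2), zero_div, zero_mul])]
  rw [if_pos ⟨rfl, rfl⟩]
  ring

/-- **`follandFreq` at a real-part coordinate of a complex place**: `q_{(re j, v)} = -2 re((w_j)_v / C_{j,v})`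
(the trace form weighs a complex place by `2 re`). [cite: Folland1989, §1.3 (1.25)] -/
theorem follandFreq_scaledFrameGen_inr_inl (w : ι → mixedSpace F) (j : ι) (v : {v : InfinitePlace F // v.IsComplex}) :
    follandFreq F ι (scaledFrameGen F ι D hD C hC) w (Sum.inr (Sum.inl j, v)) = -(2 * ((w j).2 v / C (j, v)).re) := by
  rw [follandFreq, piTracePairing_apply, neg_inj]
  simp only [mixedTrace_apply, Prod.fst_mul, Prod.snd_mul, Pi.mul_apply, scaledFrameGen_symm_apply_fst,
    scaledFrameGen_symm_apply_snd, Pi.single_apply, Sum.inr.injEq, Sum.inl.injEq, Prod.mk.injEq, reduceCtorEq,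
    if_false, false_and, zero_div, zero_mul, Finset.sum_const_zero, zero_add]
  rw [Finset.sum_eq_single_of_mem j (Finset.mem_univ _) (fun x _ hx => Finset.sum_eq_zero fun y _ => by
      rw [if_neg (fun h => hx h.1)]
      have h0 : (⟨0, 0⟩ : ℂ) = 0 := rfl
      rw [h0, mul_zero, zero_mul, Complex.zero_re, mul_zero]),
    Finset.sum_eq_single_of_mem v (Finset.mem_univ _) (fun y _ hy => by
      rw [if_neg (fun h => hy h.2)]
      have h0 : (⟨0, 0⟩ : ℂ) = 0 := rfl
      rw [h0, mul_zero, zero_mul, Complex.zero_re, mul_zero])]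
  rw [if_pos ⟨rfl, rfl⟩]
  have h1 : (⟨1, 0⟩ : ℂ) = 1 := rfl
  rw [h1, mul_one, div_eq_mul_inv, mul_comm ((w j).2 v)]

/-- **`follandFreq` at an imaginary-part coordinate of a complex place**: `q_{(im j, v)} = 2 im((w_j)_v / C_{j,v})`.
[cite: Folland1989, §1.3 (1.25)] -/
theorem follandFreq_scaledFrameGen_inr_inr (w : ι → mixedSpace F) (j : ι) (v : {v : InfinitePlace F // v.IsComplex}) :
    follandFreq F ι (scaledFrameGen F ι D hD C hC) w (Sum.inr (Sum.inr j, v)) = 2 * ((w j).2 v / C (j, v)).im := by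
  rw [follandFreq, piTracePairing_apply]
  simp only [mixedTrace_apply, Prod.fst_mul, Prod.snd_mul, Pi.mul_apply, scaledFrameGen_symm_apply_fst,
    scaledFrameGen_symm_apply_snd, Pi.single_apply, Sum.inr.injEq, Prod.mk.injEq, reduceCtorEq,
    if_false, false_and, zero_div, zero_mul, Finset.sum_const_zero, zero_add]
  rw [Finset.sum_eq_single_of_mem j (Finset.mem_univ _) (fun x _ hx => Finset.sum_eq_zero fun y _ => by
      rw [if_neg (fun h => hx h.1)]
      have h0 : (⟨0, 0⟩ : ℂ) = 0 := rfl
      rw [h0, mul_zero, zero_mul, Complex.zero_re, mul_zero]),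
    Finset.sum_eq_single_of_mem v (Finset.mem_univ _) (fun y _ hy => by
      rw [if_neg (fun h => hy h.2)]
      have h0 : (⟨0, 0⟩ : ℂ) = 0 := rfl
      rw [h0, mul_zero, zero_mul, Complex.zero_re, mul_zero])]
  rw [if_pos ⟨rfl, rfl⟩]
  have h1 : (⟨0, 1⟩ : ℂ) = Complex.I := rfl
  rw [h1, div_eq_mul_inv]
  simp only [Complex.mul_re, Complex.mul_im, Complex.I_re, Complex.I_im, mul_zero, mul_one, zero_sub]
  ring

end Freq

/-! ## §4 The Folland coordinates `Ξ_e(a, w)` of an `F`-rational Gram matrix, slice by slice -/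

section Folland

variable {D : ι × {v : InfinitePlace F // v.IsReal} → ℝ} {hD : ∀ k, D k ≠ 0}
  {C : ι × {v : InfinitePlace F // v.IsComplex} → ℂ} {hC : ∀ k, C k ≠ 0}

omit [Fintype ι] [DecidableEq ι] in
/-- the archimedean part of an `F`-rational adelic matrix `T₀ ⊗ 1` is `T₀` read through the mixed embedding.
[cite: Weil1964, Chap. III n° 37] -/
theorem archMat_map_algebraMap (T₀ : Matrix ι ι F) :
    archMat F ι (T₀.map (algebraMap F (AdeleRing (𝓞 F) F))) = T₀.map (mixedEmbedding F) := by
  refine Matrix.ext fun i j => ?_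
  unfold archMat
  rw [Matrix.map_apply, Matrix.map_apply, InfiniteAdeleRing.mixedEmbedding_eq_algebraMap_comp]
  rfl

omit [DecidableEq ι] in
/-- `T_∞ w` at a real place: `(T_∞ w)_v = σ_v(T₀) · w_v`. [cite: Weil1964, Chap. III n° 37] -/
theorem placeVec_archMat_mulVec (T₀ : Matrix ι ι F) (w : ι → mixedSpace F) (v : {v : InfinitePlace F // v.IsReal}) :
    placeVec F ι v (archMat F ι (T₀.map (algebraMap F (AdeleRing (𝓞 F) F))) *ᵥ w) =
      (T₀.map (embedding_of_isReal v.2)) *ᵥ placeVec F ι v w := by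
  funext j
  rw [archMat_map_algebraMap, placeVec_apply, Matrix.mulVec, Matrix.mulVec, dotProduct, dotProduct]
  rw [Prod.fst_sum, Finset.sum_apply]
  refine Finset.sum_congr rfl fun i _ => ?_
  rw [Matrix.map_apply, Matrix.map_apply, Prod.fst_mul, Pi.mul_apply, mixedEmbedding_apply_isReal, placeVec_apply]

omit [DecidableEq ι] in
/-- `T_∞ w` at a complex place: `(T_∞ w)_v = σ_v(T₀) · w_v`. [cite: Weil1964, Chap. III n° 37] -/
theorem placeVecC_archMat_mulVec (T₀ : Matrix ι ι F) (w : ι → mixedSpace F)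
    (v : {v : InfinitePlace F // v.IsComplex}) :
    placeVecC F ι v (archMat F ι (T₀.map (algebraMap F (AdeleRing (𝓞 F) F))) *ᵥ w) =
      (T₀.map v.1.embedding) *ᵥ placeVecC F ι v w := by
  funext j
  rw [archMat_map_algebraMap, placeVecC_apply, Matrix.mulVec, Matrix.mulVec, dotProduct, dotProduct]
  rw [Prod.snd_sum, Finset.sum_apply]
  refine Finset.sum_congr rfl fun i _ => ?_
  rw [Matrix.map_apply, Matrix.map_apply, Prod.snd_mul, Pi.mul_apply, mixedEmbedding_apply_isComplex, placeVecC_apply]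

omit [DecidableEq ι] in
/-- the real slice of `(Ξ_e(a, w)).1`: `D_{·,v} a_v`. [cite: Folland1989, Prop. (1.43)] -/
theorem realSlice_archFolland_fst (T₀ : Matrix ι ι F) (a w : ι → mixedSpace F) (v : {v : InfinitePlace F // v.IsReal}) :
    realSlice ι v (archFolland (T₀.map (algebraMap F (AdeleRing (𝓞 F) F))) (scaledFrameGen F ι D hD C hC) (a, w)).1 =
      fun j => D (j, v) * placeVec F ι v a j := rfl

/-- the real slice of `(Ξ_e(a, w)).2`: `-(σ_v(T₀) w_v) / D_{·,v}`. [cite: Folland1989, Prop. (1.43)] -/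
theorem realSlice_archFolland_snd (T₀ : Matrix ι ι F) (a w : ι → mixedSpace F) (v : {v : InfinitePlace F // v.IsReal}) :
    realSlice ι v (archFolland (T₀.map (algebraMap F (AdeleRing (𝓞 F) F))) (scaledFrameGen F ι D hD C hC) (a, w)).2 =
      fun j => -(((T₀.map (embedding_of_isReal v.2)) *ᵥ placeVec F ι v w) j) / D (j, v) := by
  funext j
  rw [realSlice_apply, archFolland_snd, follandFreq_scaledFrameGen_inl, ← placeVec_apply (F := F) (ι := ι) v,
    placeVec_archMat_mulVec]

/-- **the real slice of `Ξ_e(a, w)`** for `T = T₀ ⊗ 1`: `(D_{·,v} a_v, -(σ_v(T₀) w_v) / D_{·,v})`.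
[cite: Folland1989, Prop. (1.43)] -/
theorem realSlice_archFolland (T₀ : Matrix ι ι F) (a w : ι → mixedSpace F) (v : {v : InfinitePlace F // v.IsReal}) :
    (realSlice ι v (archFolland (T₀.map (algebraMap F (AdeleRing (𝓞 F) F))) (scaledFrameGen F ι D hD C hC) (a, w)).1,
      realSlice ι v (archFolland (T₀.map (algebraMap F (AdeleRing (𝓞 F) F))) (scaledFrameGen F ι D hD C hC) (a, w)).2) =
      ((fun j => D (j, v) * placeVec F ι v a j),
        fun j => -(((T₀.map (embedding_of_isReal v.2)) *ᵥ placeVec F ι v w) j) / D (j, v)) :=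
  Prod.ext (realSlice_archFolland_fst T₀ a w v) (realSlice_archFolland_snd T₀ a w v)

/-- **the real slice for DIAGONAL `T₀ = diag(t₀)`** is the adapted Folland scaling `follandScale (D_{·,v}) (σ_v(t₀ ·))`
of `ArchFollandTorus` — literally the formula of `archFolland_scaledFrame` (totally real `F`). [cite: Folland1989, Prop. (1.43)] -/
theorem realSlice_archFolland_diagonal (t₀ : ι → F) (a w : ι → mixedSpace F) (v : {v : InfinitePlace F // v.IsReal}) :
    (realSlice ι v (archFolland ((Matrix.diagonal t₀).map (algebraMap F (AdeleRing (𝓞 F) F)))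
        (scaledFrameGen F ι D hD C hC) (a, w)).1,
      realSlice ι v (archFolland ((Matrix.diagonal t₀).map (algebraMap F (AdeleRing (𝓞 F) F)))
        (scaledFrameGen F ι D hD C hC) (a, w)).2) =
      follandScale (fun j => D (j, v)) (fun j => embedding_of_isReal v.2 (t₀ j))
        (placeVec F ι v a, placeVec F ι v w) := by
  rw [realSlice_archFolland, follandScale_apply]
  refine Prod.ext rfl (funext fun j => ?_)
  have hdiag : (Matrix.diagonal t₀).map (embedding_of_isReal v.2) = Matrix.diagonal fun j => embedding_of_isReal v.2 (t₀ j) :=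
    Matrix.diagonal_map (map_zero _)
  simp only [hdiag, Matrix.mulVec_diagonal]
  ring

variable (ι) in
/-- **the complex Folland scaling** `cxFollandScale C T_v (a, w) = (reImVec (C a), reImVec (-2 conj(T_v w / C)))`:
the Folland coordinates of one complex place (`-2 re z = re(-2 conj z)`, `2 im z = im(-2 conj z)`).
[cite: Folland1989, Prop. (1.43)] -/
def cxFollandScale (Cv : ι → ℂ) (Tv : Matrix ι ι ℂ) (aw : (ι → ℂ) × (ι → ℂ)) : (ι ⊕ ι → ℝ) × (ι ⊕ ι → ℝ) :=
  (reImVec ι fun j => Cv j * aw.1 j, reImVec ι fun j => -2 * conj ((Tv *ᵥ aw.2) j / Cv j))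

omit [DecidableEq ι] in
/-- unfolding `cxFollandScale`. [cite: Folland1989, Prop. (1.43)] -/
@[simp] theorem cxFollandScale_apply (Cv : ι → ℂ) (Tv : Matrix ι ι ℂ) (aw : (ι → ℂ) × (ι → ℂ)) :
    cxFollandScale ι Cv Tv aw =
      (reImVec ι fun j => Cv j * aw.1 j, reImVec ι fun j => -2 * conj ((Tv *ᵥ aw.2) j / Cv j)) := rfl

omit [DecidableEq ι] in
/-- the complex slice of `(Ξ_e(a, w)).1`: `reImVec (C_{·,v} a_v)`. [cite: Folland1989, Prop. (1.43)] -/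
theorem cxSlice_archFolland_fst (T₀ : Matrix ι ι F) (a w : ι → mixedSpace F) (v : {v : InfinitePlace F // v.IsComplex}) :
    cxSlice ι v (archFolland (T₀.map (algebraMap F (AdeleRing (𝓞 F) F))) (scaledFrameGen F ι D hD C hC) (a, w)).1 =
      reImVec ι fun j => C (j, v) * placeVecC F ι v a j :=
  cxSlice_scaledFrameGen v a

/-- the complex slice of `(Ξ_e(a, w)).2`: `reImVec (-2 conj(σ_v(T₀) w_v / C_{·,v}))`. [cite: Folland1989, Prop. (1.43)] -/
theorem cxSlice_archFolland_snd (T₀ : Matrix ι ι F) (a w : ι → mixedSpace F) (v : {v : InfinitePlace F // v.IsComplex}) :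
    cxSlice ι v (archFolland (T₀.map (algebraMap F (AdeleRing (𝓞 F) F))) (scaledFrameGen F ι D hD C hC) (a, w)).2 =
      reImVec ι fun j => -2 * conj (((T₀.map v.1.embedding) *ᵥ placeVecC F ι v w) j / C (j, v)) := by
  have hw : ∀ j : ι, ((archMat F ι (T₀.map (algebraMap F (AdeleRing (𝓞 F) F))) *ᵥ w) j).2 v =
      ((T₀.map v.1.embedding) *ᵥ placeVecC F ι v w) j := fun j => by
    rw [← placeVecC_apply (F := F) (ι := ι) v, placeVecC_archMat_mulVec]
  funext i
  rcases i with j | j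
  · rw [cxSlice_apply, archFolland_snd, follandFreq_scaledFrameGen_inr_inl, reImVec_inl, hw, div_eq_mul_inv]
    simp only [Complex.mul_re, Complex.neg_re, Complex.neg_im, Complex.conj_re, Complex.conj_im, Complex.re_ofNat,
      Complex.im_ofNat]
    ring
  · rw [cxSlice_apply, archFolland_snd, follandFreq_scaledFrameGen_inr_inr, reImVec_inr, hw, div_eq_mul_inv]
    simp only [Complex.mul_im, Complex.neg_re, Complex.neg_im, Complex.conj_re, Complex.conj_im, Complex.re_ofNat,
      Complex.im_ofNat]
    ring

/-- **the complex slice of `Ξ_e(a, w)`** for `T = T₀ ⊗ 1`: `cxFollandScale (C_{·,v}) (σ_v(T₀)) (a_v, w_v)`.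
[cite: Folland1989, Prop. (1.43)] -/
theorem cxSlice_archFolland (T₀ : Matrix ι ι F) (a w : ι → mixedSpace F) (v : {v : InfinitePlace F // v.IsComplex}) :
    (cxSlice ι v (archFolland (T₀.map (algebraMap F (AdeleRing (𝓞 F) F))) (scaledFrameGen F ι D hD C hC) (a, w)).1,
      cxSlice ι v (archFolland (T₀.map (algebraMap F (AdeleRing (𝓞 F) F))) (scaledFrameGen F ι D hD C hC) (a, w)).2) =
      cxFollandScale ι (fun j => C (j, v)) (T₀.map v.1.embedding) (placeVecC F ι v a, placeVecC F ι v w) :=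
  Prod.ext (cxSlice_archFolland_fst T₀ a w v) (cxSlice_archFolland_snd T₀ a w v)

end Folland

end Literature.NumberTheory.Weil1964

end
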